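import Literature.MathematicalPhysics.QuantumFieldTheory.Balaban1983to89.B9Eq326LocalPartDivergenceRow
import Literature.MathematicalPhysics.QuantumFieldTheory.Balaban1983to89.B9Eq342GradientRowBlockCurrency

/-!
# `Balaban1983to89.B9Eq326LocalPartDivergenceBlockLetter` — T. Bałaban, *Propagators for lattice gauge theories in a background field*, Commun. Math. Phys.
# **99** (1985) 389–434 [Balaban1985BackgroundPropagators] Thm 3.1 (3.42) p. 397 (second entry, the covariant-gradient row, «for x ∈ Δ(y), supp λ ⊂ Δ(y′)»),
# (3.26) p. 395 (the local part `A₀`), (3.8) p. 392, (3.49) p. 399: **THE BLOCK LETTER (L) OF `D*_U A₀⁻¹` — the junction of this lineage's (K48)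
# `B9Eq326LocalPartDivergenceRow.norm_covDivL2K_le_weighted_uniform` (storey J's t-free divergence row of a solution of `L_K u + P u = f`, read at the
# centre `x₀ := y`) with (K52) `B9Eq342GradientRowBlockCurrency.block_letter_of_centre_rows`: for data `f` supported over ONE block `Δ(v)` with
# `sup ≤ F`, a value field with the block decay `‖u(b)‖ ≤ C_u·F·e^{−κ d_m(π b₋, v)}` (`κ ≤ aL`; the OWNER t4-ne9-p1 g94's INTENT-3
# `B9Eq326LocalPartPointRow.norm_localInv_apply_le_blockDecay` at `u = A₀⁻¹f`) and an order-zero part whose weighted row follows the value row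
# (`‖(Pu)(b)‖ ≤ c_P·N_u·W_y(b₋)` for every centre — (K47) §4 ∘ (K51)), the divergence carries the cell's letter (L):
# `‖(D*_U u)(y)‖ ≤ 2e^{a(L−1)}·(A + B·C_u)·F·e^{−κ·d_m(πy, v)}` with `A = 2|t|ΣB_ν`, `B = (2(|t|((c_P + |m|) + ε₂) + |t|δ∕β))ΣB_ν`** (the OWNER's plan v11
# §2 (ii): the letter of `D*_UA₀⁻¹`, bonds → sites, in ne9-leaf-03's (L) currency)

statement-level skeleton of published theorems with citation tags; proofs where landed; nothing here is a claim about the Yang–Mills mass gap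

CITATION HEADER (lean-in-tree rule).  Audit cell `pub-balaban`, sub-cell `t4`, BINDER row NE9; filed by NE9 crux-team LEAF PROVER 05
(`b2b-balaban-t4-ne9-formalise-leaf-05`, gen 85).  Imports this lineage's (K48) `B9Eq326LocalPartDivergenceRow` and (K52) `B9Eq342GradientRowBlockCurrency`.
SOURCE READ first-hand in the held text layer [Balaban1985BackgroundPropagators] (`paper:balaban1985-cmp99-background-propagators`): p. 397 Thm 3.1 (3.42);
p. 395 (3.26); p. 392 (3.8); p. 399 (3.49).  [folklore] composition BY NAME (the bytes are the junction reader certified in concat form as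
`g85/k52/Concat_K4852.v1.rc0.NOT-TO-FILE.lean`); nothing printed is a hypothesis; the `[cite: …]` tags are TEXT LOCATIONS.

WHAT IS PROVED (sorry-free; 0 `def`; [folklore]).  **`norm_covDivL2K_le_blockLetter`** — in the setting of (K48) (lattice `TSite d (fineP L m)`, `2 ≤ L·m_ν`,
`1 ≤ m_i`; `t > 0`, `m > 0`, rate `0 ≤ a` with `2dt²(cosh a − 1) < m`; fibre `V` read in `𝔸` along `φ`; comparison gauges with `hAd`; transporter data `R, S`;
cutoff family with its letters and supports; fibre letters `δ, b, b′`; currency `0 < β ≤ B_ν`; the t-free mass choice `a ≤ κ′`, `|t|B_ν ≤ C ≤ K∕√m`,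
`2(c∕r + |t|b)(e^{κ′} + 1)dK ≤ √m`) and of (K52) (block `v`, `sup ≤ F`, block decay `C_u`, rate `κ ≤ aL`, the order-zero implication `c_P`): the displayed (L)
letter above at every site `y`.
HONEST SCOPE.  Composition only; EVERY storey-J letter and the three rows' suppliers stay DISPLAYED (the (3.35) gradient datum `a′` inside `b′`, the margins,
`c_P`'s `k_Q`∕`E_B`, `C_u` = the OWNER's INTENT-3); nothing of [B9] Thm 3.1∕3.3∕3.11 is asserted, valued or discharged.  NOT NE9 (cell pub-balaban: NE9 NOT
PRINTED ∕ NOT PROVED; «NE9 ⇐ the named binders»; row WALLED ON A MODEL (O-NE9-1; #5 UNRULED); spine PROVED 0∕9; rung (B)+1 on a finite T⁴ — NOT infinite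
volume, NOT mass gap, NOT Clay; HONEST DEPENDENCY: continuum YM on T⁴ ⇐ BetaPertH ∧ nine spine estimates (0/9 proved); BetaPertH ⇐ (D1) ∧ (D4) ∧ CAP+tail;
G-an2-4 gates asym, D1 and NE2/3/4).  NEW file; nothing modified.  Net new unproved facts: 0.
-/

noncomputable section

set_option autoImplicit false

namespace Literature.MathematicalPhysics.QuantumFieldTheory.Balaban1983to89.B9Eq326LocalPartDivergenceBlockLetter


open scoped BigOperators InnerProductSpace

open B4Sect5Torus (TSite tdist)
open B9SectCLatticeCarrier (Bond bpos btgt shift unshift)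
open B4TorusKernel.MultiPeriod (circAbs)
open B9Eq311L2Pairing (WL2)
open B9Eq310HessianOperator (adTransportW)
open B11Eq103H1Complex (BondL2K covDivL2K)
open B9Eq328GaugeAction (gaugeU AdW)
open B9Eq319QprimeTorus (fineP blockCoord)
open B9Eq326LocalPartKatoForm (bondLapK)
open B9Eq326LocalPartDivergenceRow (norm_covDivL2K_le_weighted_uniform)
open B9Eq342GradientRowBlockCurrency (block_letter_of_centre_rows)

variable {d : ℕ} (L : ℕ) [NeZero L] (m : Fin d → ℕ) [∀ i, NeZero (fineP L m i)] (hm : ∀ i, 1 ≤ m i)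
  {𝔸 : Type*} [Ring 𝔸] [Algebra ℂ 𝔸] {V : Type*} [NormedAddCommGroup V] [InnerProductSpace ℂ V] [FiniteDimensional ℂ V] (φ : V ≃ₗ[ℂ] 𝔸) {c₁ : ℝ} [Fact (0 < c₁)]
  (t mm a : ℝ) (hmm : 0 < mm) (gf : Bond d (fineP L m) → TSite d (fineP L m) → 𝔸ˣ)
  (hAdf : ∀ (b₀ : Bond d (fineP L m)) (x : TSite d (fineP L m)) (v v' : V), ⟪AdW φ (gf b₀ x) v, AdW φ (gf b₀ x) v'⟫_ℂ = ⟪v, v'⟫_ℂ)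

local notation "BC" => (fun ν : Fin d => (1 + Real.exp (-a)) * ((1 + 2 * t / (fineP L m ν * Real.sqrt (mm - 2 * ((d : ℝ) - 1) * t ^ 2 * (Real.cosh a - 1)))) /
      Real.sqrt ((mm - 2 * ((d : ℝ) - 1) * t ^ 2 * (Real.cosh a - 1)) ^ 2 + 4 * (mm - 2 * ((d : ℝ) - 1) * t ^ 2 * (Real.cosh a - 1)) * t ^ 2)) +
    2 * Real.sinh a / (mm - 2 * (d : ℝ) * t ^ 2 * (Real.cosh a - 1)))
local notation "RP[" b₀ "]" => (adTransportW φ (gaugeU (gf b₀) 1) : Bond d (fineP L m) → V →ₗ[ℂ] V)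
local notation "SP[" b₀ "]" => (adTransportW φ (fun bb => (gaugeU (gf b₀) 1 bb)⁻¹) : Bond d (fineP L m) → V →ₗ[ℂ] V)

include hm hmm hAdf in
/-- **THE BLOCK LETTER (L) OF THE DIVERGENCE OF THE LOCAL PART's SOLUTION** — see the module header: (K48)'s t-free divergence row at the centre
`x₀ := y` inhabits (K52)'s row functional; block-supported data, block-decaying value field and the order-zero implication give
`‖(D*_U u)(y)‖ ≤ 2e^{a(L−1)}·(A + B·C_u)·F·e^{−κ·d_m(πy, v)}`. [folklore] [cite: Balaban1985BackgroundPropagators, Thm 3.1 (3.42) p.397, (3.26) p.395, (3.8) p.392, (3.49) p.399] -/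
theorem norm_covDivL2K_le_blockLetter (ht : 0 < t) (ha : 0 ≤ a) (hlam : 2 * (d : ℝ) * t ^ 2 * (Real.cosh a - 1) < mm)
    (hn : ∀ ν, 2 ≤ fineP L m ν) (R S : Bond d (fineP L m) → V →ₗ[ℂ] V) (hSR : ∀ b w, S b (R b w) = w) (hRc : ∀ b w, ‖R b w‖ ≤ ‖w‖)
    (hSc : ∀ b w, ‖S b w‖ ≤ ‖w‖)
    (P : BondL2K ℂ d (fineP L m) c₁ V →ₗ[ℂ] BondL2K ℂ d (fineP L m) c₁ V) (u f : BondL2K ℂ d (fineP L m) c₁ V)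
    (hu : bondLapK ℂ c₁ (t : ℂ) R S u + P u = f)
    -- the data over one block, the value field with block decay, the order-zero part's row from the value row (centre-uniform)
    (v : TSite d m) {F Cu κ cP : ℝ} (hF : 0 ≤ F) (hCu : 0 ≤ Cu) (hκ : 0 ≤ κ) (hκa : κ ≤ a * (L : ℝ)) (hcP : 0 ≤ cP)
    (hfv : ∀ b : Bond d (fineP L m), blockCoord L m b.1 ≠ v → WL2.equiv ℂ (fun _ : Bond d (fineP L m) => c₁) V f b = 0)
    (hfF : ∀ b : Bond d (fineP L m), ‖WL2.equiv ℂ (fun _ : Bond d (fineP L m) => c₁) V f b‖ ≤ F)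
    (hudec : ∀ b : Bond d (fineP L m), ‖WL2.equiv ℂ (fun _ : Bond d (fineP L m) => c₁) V u b‖ ≤
      Cu * F * Real.exp (-(κ * tdist m (blockCoord L m b.1) v)))
    (hPuv : ∀ (y : TSite d (fineP L m)) (Nu : ℝ), 0 ≤ Nu →
      (∀ b : Bond d (fineP L m), ‖WL2.equiv ℂ (fun _ : Bond d (fineP L m) => c₁) V u b‖ ≤ Nu *
        (fun x : TSite d (fineP L m) =>
          ∏ μ, Real.cosh (a * (circAbs (fineP L m μ) (ZMod.val (((y μ : ℕ) : ZMod (fineP L m μ)) - ((x μ : ℕ) : ZMod (fineP L m μ)))) : ℝ))) b.1) →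
      ∀ b : Bond d (fineP L m), ‖WL2.equiv ℂ (fun _ : Bond d (fineP L m) => c₁) V (P u) b‖ ≤ (cP * Nu) *
        (fun x : TSite d (fineP L m) =>
          ∏ μ, Real.cosh (a * (circAbs (fineP L m μ) (ZMod.val (((y μ : ℕ) : ZMod (fineP L m μ)) - ((x μ : ℕ) : ZMod (fineP L m μ)))) : ℝ))) b.1)
    -- storey J's centre-independent letters
    (χ : Bond d (fineP L m) → TSite d (fineP L m) → ℝ) (hχ1 : ∀ b₀ y, |χ b₀ y| ≤ 1) (hχp : ∀ b₀, χ b₀ (bpos b₀) = 1)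
    (hχt : ∀ b₀, χ b₀ (btgt b₀) = 1)
    {c r : ℝ} (hcr : 0 ≤ c / r) (hcr2 : 0 ≤ c / r ^ 2) (h1p : ∀ b₀ x μ, |t * (χ b₀ (shift μ x) - χ b₀ x)| ≤ c / r)
    (h1m : ∀ b₀ x μ, |t * (χ b₀ x - χ b₀ (unshift μ x))| ≤ c / r) (h2 : ∀ b₀ x μ, |t ^ 2 * (2 * χ b₀ x - χ b₀ (shift μ x) - χ b₀ (unshift μ x))| ≤ c / r ^ 2)
    (Ω : Bond d (fineP L m) → Set (TSite d (fineP L m)))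
    (hΩ : ∀ b₀ x, x ∉ Ω b₀ → χ b₀ x = 0 ∧ (∀ μ, χ b₀ (shift μ x) = 0) ∧ (∀ μ, χ b₀ (unshift μ x) = 0))
    {δ b b' : ℝ} (hδ0 : 0 ≤ δ) (hb : 0 ≤ b) (hb' : 0 ≤ b') (hδ : ∀ b₀ w, ‖R b₀ w - RP[b₀] b₀ w‖ ≤ δ * ‖w‖)
    (hBp : ∀ b₀, ∀ x ∈ Ω b₀, ∀ μ w, ‖RP[b₀] (x, μ) (S (x, μ) w) - w‖ ≤ b * ‖w‖)
    (hBm : ∀ b₀, ∀ x ∈ Ω b₀, ∀ μ w, ‖RP[b₀] (unshift μ x, μ) (S (unshift μ x, μ) w) - w‖ ≤ b * ‖w‖)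
    (hBt : ∀ b₀, ∀ x ∈ Ω b₀, ∀ μ w, ‖SP[b₀] (unshift μ x, μ) w - S (unshift μ x, μ) w‖ ≤ b * ‖w‖)
    (hD : ∀ b₀, ∀ x ∈ Ω b₀, ∀ μ w, ‖(RP[b₀] (x, μ) (S (x, μ) w) - w) -
      SP[b₀] (unshift μ x, μ) (RP[b₀] (unshift μ x, μ) (S (unshift μ x, μ) (RP[b₀] (unshift μ x, μ) w)) - RP[b₀] (unshift μ x, μ) w)‖ ≤ b' * ‖w‖)
    {β : ℝ} (hβ : 0 < β) (hβB : ∀ ν, β ≤ BC ν)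
    {κ' C K : ℝ} (haκ : a ≤ κ') (hC : 0 ≤ C) (htB : ∀ ν, ‖(t : ℂ)‖ * BC ν ≤ C) (hCK : C ≤ K / Real.sqrt mm)
    (hmK : 2 * ((c / r + |t| * b) * (Real.exp κ' + 1) * (d : ℝ) * K) ≤ Real.sqrt mm) (y : TSite d (fineP L m)) :
    ‖WL2.equiv ℂ (fun _ : TSite d (fineP L m) => c₁) V (covDivL2K ℂ c₁ (t : ℂ) S u) y‖ ≤
      2 * Real.exp (a * ((L : ℝ) - 1)) *
        ((2 * ‖(t : ℂ)‖ * ∑ ν, BC ν) +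
          (2 * (‖(t : ℂ)‖ * ((cP + ‖((mm : ℝ) : ℂ)‖) +
            ((d : ℝ) * (c / r ^ 2) + |t| * b * (c / r) * ((d : ℝ) * (1 + Real.exp a)) + (d : ℝ) * (t ^ 2 * (b' + b * b)))) + |t| * δ / β) *
            ∑ ν, BC ν) * Cu) * F * Real.exp (-(κ * tdist m (blockCoord L m y) v)) := by
  refine block_letter_of_centre_rows L m hm ha (fun b : Bond d (fineP L m) => b.1) (fun b : Bond d (fineP L m) => b.1)
    (fun b => WL2.equiv ℂ (fun _ : Bond d (fineP L m) => c₁) V f b) (fun b => WL2.equiv ℂ (fun _ : Bond d (fineP L m) => c₁) V u b)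
    (fun y => WL2.equiv ℂ (fun _ : TSite d (fineP L m) => c₁) V (covDivL2K ℂ c₁ (t : ℂ) S u) y) v hF hCu hκ hκa hfv hfF hudec
    (fun y Γ Nu hΓ hNu hfy huy => ?_) y
  have h48 := norm_covDivL2K_le_weighted_uniform φ t mm a hmm y gf hAdf ht ha hlam hn R S hSR hRc hSc P u f hu hΓ (mul_nonneg hcP hNu) hNu hfy
    (hPuv y Nu hNu huy) huy χ hχ1 hχp hχt hcr hcr2 h1p h1m h2 Ω hΩ hδ0 hb hb' hδ hBp hBm hBt hD hβ hβB haκ hC htB hCK hmK y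
  refine h48.trans (le_of_eq ?_)
  rw [← Finset.mul_sum]
  ring

end Literature.MathematicalPhysics.QuantumFieldTheory.Balaban1983to89.B9Eq326LocalPartDivergenceBlockLetter

end
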